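import Literature.Probability.RandomPlanarGeometry.DrivingConvergenceEngine
import HarnessLib

/-!
# Capacity sampling of a continuous driving function: the stopping capacities of [LSW04] §3.3

Topic `Probability/RandomPlanarGeometry`, sub-namespace `SkorokhodEmbedding` (companion of
`DrivingConvergenceEngine.lean`). Everything here is PROVED; no named fact is introduced.

Lawler–Schramm–Werner (2004), §3.3 (arXiv math/0112234, p. 14), sample the Loewner driving
function `Δ` of the discrete curve along the stopping indices "`m₀ = 0`, and `m_{n+1}` the first
`j > m_n` with `|Δ_{t_j} - Δ_{t_{m_n}}| ≥ δ` or `t_j - t_{m_n} ≥ δ²`", so that between consecutive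
sampling times the driving function moves by at most `δ` plus one lattice step and the capacity
by at most `δ²` plus one lattice step, while at each sampling step `(ΔΔ)² + Δt ≥ δ²`. The engine
of the tree (`RawDrivingData.IsValid`, `exists_delta_forall_coupling_lt`) consumes exactly these
deterministic clauses together with the two conditional-moment ("key") estimates.

This file performs the sampling once and for all for a CONTINUOUS driving function read in
continuous (capacity) time — the special case of the printed recipe in which the overshoot is
zero: `nextStop W δ s` is the least capacity `u ≥ s` with `|W u - W s| ≥ δ` or `u ≥ s + δ²`
(a minimum, `W` being continuous), and `capStop W δ k` iterates it from `0`.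
-- TODO(general form): the printed `m_n` run over LATTICE indices `j` (first lattice step past the
-- threshold); the continuous-time version below is what a curve read through its capacity
-- parametrisation supplies, and is the input shape of `RawDrivingData`.

Results:

* `nextStop_mem`, `le_nextStop`, `coe_nextStop_le`, `abs_sub_lt_of_lt_nextStop`,
  `abs_sub_nextStop_le`, `sq_le_sq_add_sub_nextStop` — the stop exists, `s ≤ nextStop ≤ s + δ²`,
  `|W u - W s| < δ` before it and `≤ δ` at it, and the lower bound `(ΔW)² + Δt ≥ δ²`;
* `nextStop_congr`, `capStop_congr` — LOCALITY: the stops up to index `k` depend only on the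
  path up to the `k`-th stop (so sampled data are adapted to any filtration determining it);
* `sampledData`, `sampledData_isValid`, `sampledData_lowerFailSet_subset` — the raw driving
  data of a finite family of continuous paths sampled at the stops and FROZEN from a truncation
  index `τ` on are valid (`RawDrivingData.IsValid`) once the histories determine the path up to
  the current stop and `τ ∧ k`, and the two key estimates hold; the lower bound fails only on
  `{τ < N}` ([LSW04] proof of Thm. 4.4, arXiv p. 23: "`0` may be swallowed before time `T`").

## References

* G. F. Lawler, O. Schramm, W. Werner, *Conformal invariance of planar loop-erased random walks
  and uniform spanning trees*, Ann. Probab. 32 (2004), §3.3 (proof of Thm. 3.7) and proof of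
  Thm. 4.4 [LawlerSchrammWerner2004].
-/

noncomputable section

open MeasureTheory Filter Set
open scoped NNReal Topology

namespace Literature.Probability.RandomPlanarGeometry.SkorokhodEmbedding

/-! ### One sampling step -/

/-- The **stopping set** after capacity `s` at resolution `δ`: the capacities `u ≥ s` at which the
path has moved by at least `δ` from its value at `s`, or `δ²` units of capacity have elapsed
([LSW04] §3.3: "`|Δ_{t_j} - Δ_{t_{m_n}}| ≥ δ` or `t_j - t_{m_n} ≥ δ²`").
[cite: LawlerSchrammWerner2004, Theorem 3.7] -/
def stopSet (W : C(ℝ≥0, ℝ)) (δ : ℝ) (s : ℝ≥0) : Set ℝ≥0 :=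
  {u | s ≤ u ∧ (δ ≤ |W u - W s| ∨ (s : ℝ) + δ ^ 2 ≤ u)}

/-- The **next sampling capacity** after `s`: the least element of the stopping set (a minimum,
`nextStop_mem`). [cite: LawlerSchrammWerner2004, Theorem 3.7] -/
def nextStop (W : C(ℝ≥0, ℝ)) (δ : ℝ) (s : ℝ≥0) : ℝ≥0 :=
  sInf (stopSet W δ s)

/-- The **sampling capacities** `t_{m_0} = 0, t_{m_{k+1}} = nextStop (t_{m_k})` of the path `W`
at resolution `δ`. [cite: LawlerSchrammWerner2004, Theorem 3.7] -/
def capStop (W : C(ℝ≥0, ℝ)) (δ : ℝ) : ℕ → ℝ≥0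
  | 0 => 0
  | k + 1 => nextStop W δ (capStop W δ k)

section Step

variable (W : C(ℝ≥0, ℝ)) (δ : ℝ) (s : ℝ≥0)

/-- Membership in the stopping set. [folklore] -/
theorem mem_stopSet {u : ℝ≥0} :
    u ∈ stopSet W δ s ↔ s ≤ u ∧ (δ ≤ |W u - W s| ∨ (s : ℝ) + δ ^ 2 ≤ u) := Iff.rfl

/-- The stopping set is closed (the path is continuous). [folklore] -/
theorem isClosed_stopSet : IsClosed (stopSet W δ s) := by
  have h1 : IsClosed {u : ℝ≥0 | s ≤ u} := isClosed_Ici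
  have h2 : IsClosed {u : ℝ≥0 | δ ≤ |W u - W s|} :=
    isClosed_le continuous_const ((W.continuous.sub continuous_const).abs)
  have h3 : IsClosed {u : ℝ≥0 | (s : ℝ) + δ ^ 2 ≤ u} :=
    isClosed_le continuous_const NNReal.continuous_coe
  exact h1.inter (h2.union h3)

/-- The capacity `s + δ²` belongs to the stopping set. [folklore] -/
theorem add_toNNReal_sq_mem_stopSet : s + Real.toNNReal (δ ^ 2) ∈ stopSet W δ s := by
  refine ⟨le_self_add, Or.inr ?_⟩
  rw [NNReal.coe_add, Real.coe_toNNReal _ (sq_nonneg δ)]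

/-- **The next stop is attained**: `nextStop W δ s ∈ stopSet W δ s`. [folklore] -/
theorem nextStop_mem : nextStop W δ s ∈ stopSet W δ s :=
  (isClosed_stopSet W δ s).csInf_mem ⟨_, add_toNNReal_sq_mem_stopSet W δ s⟩ (OrderBot.bddBelow _)

/-- The next stop is not before `s`. [folklore] -/
theorem le_nextStop : s ≤ nextStop W δ s :=
  (nextStop_mem W δ s).1

/-- The next stop is at most `s + δ²` (as nonnegative reals). [folklore] -/
theorem nextStop_le : nextStop W δ s ≤ s + Real.toNNReal (δ ^ 2) :=
  csInf_le (OrderBot.bddBelow _) (add_toNNReal_sq_mem_stopSet W δ s)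

/-- **The capacity increment of one step is at most `δ²`**: `nextStop W δ s ≤ s + δ²`.
[cite: LawlerSchrammWerner2004, Theorem 3.7] -/
theorem coe_nextStop_le : (nextStop W δ s : ℝ) ≤ s + δ ^ 2 := by
  have h := nextStop_le W δ s
  rw [← NNReal.coe_le_coe, NNReal.coe_add, Real.coe_toNNReal _ (sq_nonneg δ)] at h
  exact h

/-- **Before the stop the path has moved by less than `δ`.** [cite: LawlerSchrammWerner2004, Theorem 3.7] -/
theorem abs_sub_lt_of_lt_nextStop {u : ℝ≥0} (hsu : s ≤ u) (hu : u < nextStop W δ s) :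
    |W u - W s| < δ := by
  by_contra h
  have hmem : u ∈ stopSet W δ s := ⟨hsu, Or.inl (not_lt.1 h)⟩
  exact absurd (csInf_le (OrderBot.bddBelow _) hmem) (not_le.2 hu)

variable {δ}

/-- **At the stop the path has moved by at most `δ`** (for `δ ≥ 0`; continuity from the left).
[cite: LawlerSchrammWerner2004, Theorem 3.7] -/
theorem abs_sub_nextStop_le (hδ : 0 ≤ δ) : |W (nextStop W δ s) - W s| ≤ δ := by
  set n := nextStop W δ s with hn
  rcases (le_nextStop W δ s).eq_or_lt with h | h
  · rw [← hn] at h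
    rw [← h, sub_self, abs_zero]
    exact hδ
  · -- `Ico s n ⊆ {u | |W u - W s| ≤ δ}`, a closed set, hence its closure `Icc s n` too
    have hC : IsClosed {u : ℝ≥0 | |W u - W s| ≤ δ} :=
      isClosed_le ((W.continuous.sub continuous_const).abs) continuous_const
    have hsub : Ico s n ⊆ {u : ℝ≥0 | |W u - W s| ≤ δ} := fun u hu ↦
      (abs_sub_lt_of_lt_nextStop W δ s hu.1 hu.2).le
    have hcl : closure (Ico s n) ⊆ {u : ℝ≥0 | |W u - W s| ≤ δ} := hC.closure_subset_iff.2 hsub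
    rw [closure_Ico h.ne] at hcl
    exact hcl ⟨h.le, le_rfl⟩

/-- Hence on the whole closed step `[s, nextStop]` the path stays within `δ` of its initial value.
[cite: LawlerSchrammWerner2004, Theorem 3.7] -/
theorem abs_sub_le_of_le_nextStop (hδ : 0 ≤ δ) {u : ℝ≥0} (hsu : s ≤ u) (hu : u ≤ nextStop W δ s) :
    |W u - W s| ≤ δ := by
  rcases hu.lt_or_eq with h | h
  · exact (abs_sub_lt_of_lt_nextStop W δ s hsu h).le
  · rw [h]; exact abs_sub_nextStop_le W s hδ

/-- **The defining lower bound of a sampling step**: `(W(next) - W(s))² + (next - s) ≥ δ²`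
(either the path moved by `δ` or `δ²` units of capacity elapsed).
[cite: LawlerSchrammWerner2004, Theorem 3.7] -/
theorem sq_le_sq_add_sub_nextStop (hδ : 0 ≤ δ) :
    δ ^ 2 ≤ (W (nextStop W δ s) - W s) ^ 2 + ((nextStop W δ s : ℝ) - s) := by
  have hnn : (0 : ℝ) ≤ (nextStop W δ s : ℝ) - s := sub_nonneg.2 (by exact_mod_cast le_nextStop W δ s)
  rcases (nextStop_mem W δ s).2 with h | h
  · have h1 : δ ^ 2 ≤ (W (nextStop W δ s) - W s) ^ 2 := by
      rw [← sq_abs (W _ - W s)]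
      exact pow_le_pow_left₀ hδ h 2
    linarith
  · have h2 : δ ^ 2 ≤ (nextStop W δ s : ℝ) - s := by linarith
    linarith [sq_nonneg (W (nextStop W δ s) - W s)]

/-- **Locality of one step**: if `W'` agrees with `W` up to a capacity `u₀` beyond the stop of `W`
after `s`, then `W'` has the same stop after `s`. [folklore] -/
theorem nextStop_congr {W' : C(ℝ≥0, ℝ)} {u₀ : ℝ≥0} (h : ∀ u ≤ u₀, W' u = W u)
    (h₀ : nextStop W δ s ≤ u₀) : nextStop W' δ s = nextStop W δ s := by
  have hs : W' s = W s := h s ((le_nextStop W δ s).trans h₀)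
  have hiff : ∀ u ≤ u₀, (u ∈ stopSet W' δ s ↔ u ∈ stopSet W δ s) := fun u hu ↦ by
    simp only [mem_stopSet, h u hu, hs]
  apply le_antisymm
  · exact csInf_le (OrderBot.bddBelow _) ((hiff _ h₀).2 (nextStop_mem W δ s))
  · have hle : nextStop W' δ s ≤ nextStop W δ s :=
      csInf_le (OrderBot.bddBelow _) ((hiff _ h₀).2 (nextStop_mem W δ s))
    exact csInf_le (OrderBot.bddBelow _) ((hiff _ (hle.trans h₀)).1 (nextStop_mem W' δ s))

end Step

/-! ### The sampling capacities -/

section Stops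

variable (W : C(ℝ≥0, ℝ)) (δ : ℝ)

/-- The sampling starts at capacity `0`. [folklore] -/
@[simp] theorem capStop_zero : capStop W δ 0 = 0 := rfl

/-- The recursion of the sampling capacities. [folklore] -/
theorem capStop_succ (k : ℕ) : capStop W δ (k + 1) = nextStop W δ (capStop W δ k) := rfl

/-- The sampling capacities are nondecreasing, one step. [folklore] -/
theorem capStop_le_succ (k : ℕ) : capStop W δ k ≤ capStop W δ (k + 1) :=
  le_nextStop W δ _

/-- The sampling capacities are monotone. [folklore] -/
theorem monotone_capStop : Monotone (capStop W δ) :=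
  monotone_nat_of_le_succ (capStop_le_succ W δ)

/-- **Capacity increments are at most `δ²`.** [cite: LawlerSchrammWerner2004, Theorem 3.7] -/
theorem coe_capStop_succ_sub_le (k : ℕ) :
    (capStop W δ (k + 1) : ℝ) - capStop W δ k ≤ δ ^ 2 := by
  have := coe_nextStop_le W δ (capStop W δ k)
  rw [capStop_succ]; linarith

variable {δ}

/-- **Driving increments are at most `δ`.** [cite: LawlerSchrammWerner2004, Theorem 3.7] -/
theorem abs_capStop_succ_sub_le (hδ : 0 ≤ δ) (k : ℕ) :
    |W (capStop W δ (k + 1)) - W (capStop W δ k)| ≤ δ :=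
  abs_sub_nextStop_le W _ hδ

/-- **Oscillation `≤ δ` between consecutive sampling capacities.**
[cite: LawlerSchrammWerner2004, Theorem 3.7] -/
theorem abs_sub_capStop_le (hδ : 0 ≤ δ) (k : ℕ) {u : ℝ≥0} (h₁ : capStop W δ k ≤ u)
    (h₂ : u ≤ capStop W δ (k + 1)) : |W u - W (capStop W δ k)| ≤ δ :=
  abs_sub_le_of_le_nextStop W _ hδ h₁ h₂

/-- **The lower bound at every sampling step**: `(ΔW)² + Δt ≥ δ²`.
[cite: LawlerSchrammWerner2004, Theorem 3.7] -/
theorem sq_le_capStop_step (hδ : 0 ≤ δ) (k : ℕ) :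
    δ ^ 2 ≤ (W (capStop W δ (k + 1)) - W (capStop W δ k)) ^ 2 +
      ((capStop W δ (k + 1) : ℝ) - capStop W δ k) :=
  sq_le_sq_add_sub_nextStop W _ hδ

variable (δ) in
/-- **Locality of the sampling**: if `W'` agrees with `W` up to a capacity `u₀` beyond the `k`-th
sampling capacity of `W`, then the first `k` sampling capacities of `W'` and `W` coincide
(induction on `nextStop_congr`). [folklore] -/
theorem capStop_congr {W' : C(ℝ≥0, ℝ)} {u₀ : ℝ≥0} (h : ∀ u ≤ u₀, W' u = W u) {k : ℕ}
    (hk : capStop W δ k ≤ u₀) : ∀ j ≤ k, capStop W' δ j = capStop W δ j := by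
  induction k with
  | zero => intro j hj; rw [Nat.le_zero.1 hj]; rfl
  | succ k ih =>
    intro j hj
    have hk' : capStop W δ k ≤ u₀ := (capStop_le_succ W δ k).trans hk
    rcases Nat.of_le_succ hj with hj' | rfl
    · exact ih hk' j hj'
    · rw [capStop_succ, capStop_succ, ih hk' k le_rfl]
      exact nextStop_congr W _ h hk

end Stops

/-! ### Sampled raw driving data with truncation -/

section Sampled

variable {Ω Λ : Type} [MeasurableSpace Ω]

/-- **The raw driving data of a finite family of continuous paths sampled at the stopping
capacities and frozen from the truncation index `τ` on**: histories `H`, mesh `δ`, capacities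
`t_k(ω) = capStop (drv ω) δ (k ∧ τ ω)`, driving values `drv ω (t_k ω)`, diffusivity `κ` and key
constants `C₁, C₂` ([LSW04] §3.3 for the sampling; proof of Thm. 4.4, arXiv p. 23, for the
freezing at a truncation index). [cite: LawlerSchrammWerner2004, Theorem 3.7] -/
def sampledData (P : Measure Ω) (H : ℕ → Ω → Λ) (drv : Ω → C(ℝ≥0, ℝ)) (τ : Ω → ℕ)
    (δ κ C₁ C₂ : ℝ) : RawDrivingData Ω Λ where
  P := P
  H := H
  δ := δ
  tcap k ω := capStop (drv ω) δ (min k (τ ω))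
  dval k ω := drv ω (capStop (drv ω) δ (min k (τ ω)))
  drv := drv
  κ := κ
  C₁ := C₁
  C₂ := C₂

variable (P : Measure Ω) (H : ℕ → Ω → Λ) (drv : Ω → C(ℝ≥0, ℝ)) (τ : Ω → ℕ) (δ κ C₁ C₂ : ℝ)

/-- The capacities of the sampled data (definitional). [folklore] -/
@[simp] theorem sampledData_tcap (k : ℕ) (ω : Ω) :
    (sampledData P H drv τ δ κ C₁ C₂).tcap k ω = capStop (drv ω) δ (min k (τ ω)) := rfl

/-- The driving values of the sampled data (definitional). [folklore] -/
@[simp] theorem sampledData_dval (k : ℕ) (ω : Ω) :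
    (sampledData P H drv τ δ κ C₁ C₂).dval k ω = drv ω (capStop (drv ω) δ (min k (τ ω))) := rfl

/-- The truncated index advances by at most one step. [folklore] -/
theorem min_succ_eq_or (k n : ℕ) : min (k + 1) n = min k n ∨ min (k + 1) n = min k n + 1 := by
  omega

variable {P H drv τ δ κ C₁ C₂}

omit [MeasurableSpace Ω] in
/-- **One (possibly frozen) step of the sampled data**: the capacity increment is `≤ δ²`, the
driving increment `≤ δ`, the oscillation in between `≤ δ`, and either the step is frozen
(`k ∧ τ = (k+1) ∧ τ`, zero increments) or it is a genuine sampling step obeying the lower bound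
`(ΔW)² + Δt ≥ δ²`. [cite: LawlerSchrammWerner2004, Theorem 3.7] -/
theorem sampledData_step (hδ : 0 ≤ δ) (k : ℕ) (ω : Ω) :
    ((capStop (drv ω) δ (min (k + 1) (τ ω)) : ℝ) - capStop (drv ω) δ (min k (τ ω)) ≤ δ ^ 2) ∧
    |drv ω (capStop (drv ω) δ (min (k + 1) (τ ω))) - drv ω (capStop (drv ω) δ (min k (τ ω)))| ≤ δ ∧
    (∀ u : ℝ≥0, capStop (drv ω) δ (min k (τ ω)) ≤ u → u ≤ capStop (drv ω) δ (min (k + 1) (τ ω)) →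
      |drv ω u - drv ω (capStop (drv ω) δ (min k (τ ω)))| ≤ δ) ∧
    (min (k + 1) (τ ω) = min k (τ ω) ∨
      δ ^ 2 ≤ (drv ω (capStop (drv ω) δ (min (k + 1) (τ ω))) -
        drv ω (capStop (drv ω) δ (min k (τ ω)))) ^ 2 +
        ((capStop (drv ω) δ (min (k + 1) (τ ω)) : ℝ) - capStop (drv ω) δ (min k (τ ω)))) := by
  rcases min_succ_eq_or k (τ ω) with h | h
  · -- frozen step
    rw [h]
    refine ⟨by rw [sub_self]; positivity, by rw [sub_self, abs_zero]; exact hδ, fun u h₁ h₂ ↦ ?_, Or.inl rfl⟩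
    rw [le_antisymm h₂ h₁, sub_self, abs_zero]; exact hδ
  · -- genuine sampling step
    rw [h]
    exact ⟨coe_capStop_succ_sub_le _ δ _, abs_capStop_succ_sub_le _ hδ _,
      fun u h₁ h₂ ↦ abs_sub_capStop_le _ hδ _ h₁ h₂, Or.inr (sq_le_capStop_step _ hδ _)⟩

/-- **The sampled data are valid raw driving data** up to the horizon `N` ([LSW04] §3.3 with the
freezing of the proof of Thm. 4.4), provided: `P` is a probability law, the histories refine,
`0 < δ`, `C₁ δ² ≤ 1` (so that `δ ≤ 2δ - C₁δ³`), `κ, C₁, C₂ ≥ 0`, every path starts at `0`, the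
history at index `k` DETERMINES THE PATH UP TO THE CURRENT SAMPLING CAPACITY and the truncated
index `k ∧ τ` (causality — cf. `capStop_congr`), and the two key estimates hold atom by atom:
`|E[ΔΔ | 𝓕_k]| ≤ C₁ δ³` at all indices and `|E[(ΔΔ)² - κ Δt | 𝓕_k]| ≤ C₂ δ³` below `N`.
[cite: LawlerSchrammWerner2004, Theorem 3.7] -/
theorem sampledData_isValid [Fintype Ω] [DecidableEq Λ] {N : ℕ} (hP : IsProbabilityMeasure P)
    (hrefine : ∀ ⦃k n : ℕ⦄ ⦃ω ω' : Ω⦄, k ≤ n → H n ω = H n ω' → H k ω = H k ω')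
    (hδ : 0 < δ) (hC₁δ : C₁ * δ ^ 2 ≤ 1) (hκ : 0 ≤ κ) (hC₁ : 0 ≤ C₁) (hC₂ : 0 ≤ C₂)
    (h0 : ∀ ω, drv ω 0 = 0)
    (hpath : ∀ k ω ω', H k ω = H k ω' →
      ∀ u ≤ capStop (drv ω) δ (min k (τ ω)), drv ω' u = drv ω u)
    (hτ : ∀ k ω ω', H k ω = H k ω' → min k (τ ω) = min k (τ ω'))
    (hmean : ∀ k l, |(sampledData P H drv τ δ κ C₁ C₂).base.condMean k
      (fun ω ↦ (sampledData P H drv τ δ κ C₁ C₂).dval (k + 1) ω -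
        (sampledData P H drv τ δ κ C₁ C₂).dval k ω) l| ≤ C₁ * δ ^ 3)
    (hkey : ∀ k < N, ∀ l, |(sampledData P H drv τ δ κ C₁ C₂).base.condMean k
      (fun ω ↦ ((sampledData P H drv τ δ κ C₁ C₂).dval (k + 1) ω -
        (sampledData P H drv τ δ κ C₁ C₂).dval k ω) ^ 2 -
        κ * (((sampledData P H drv τ δ κ C₁ C₂).tcap (k + 1) ω : ℝ) -
          (sampledData P H drv τ δ κ C₁ C₂).tcap k ω)) l| ≤ C₂ * δ ^ 3) :
    (sampledData P H drv τ δ κ C₁ C₂).IsValid N where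
  prob := hP
  refine := hrefine
  δ_pos := hδ
  κ_nonneg := hκ
  C₁_nonneg := hC₁
  C₂_nonneg := hC₂
  t_adapt k ω ω' h := by
    simp only [sampledData_tcap]
    rw [← hτ k ω ω' h]
    exact (capStop_congr (drv ω) δ (hpath k ω ω' h) le_rfl _ le_rfl).symm
  d_adapt k ω ω' h := by
    simp only [sampledData_dval]
    have hc : capStop (drv ω') δ (min k (τ ω)) = capStop (drv ω) δ (min k (τ ω)) :=
      capStop_congr (drv ω) δ (hpath k ω ω' h) le_rfl _ le_rfl
    rw [← hτ k ω ω' h, hc]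
    exact (hpath k ω ω' h _ le_rfl).symm
  t_zero ω := by simp
  d_zero ω := by simpa using h0 ω
  t_mono k ω := by
    simp only [sampledData_tcap]
    exact monotone_capStop _ δ (min_le_min_right _ (Nat.le_succ k))
  t_inc k _ ω := by
    have h := (sampledData_step (drv := drv) (τ := τ) hδ.le k ω).1
    show ((capStop (drv ω) δ (min (k + 1) (τ ω)) : ℝ) - capStop (drv ω) δ (min k (τ ω))) ≤
      2 * δ ^ 2
    nlinarith [sq_nonneg δ]
  d_inc k ω := by
    have h := (sampledData_step (drv := drv) (τ := τ) hδ.le k ω).2.1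
    show |drv ω (capStop (drv ω) δ (min (k + 1) (τ ω))) -
      drv ω (capStop (drv ω) δ (min k (τ ω)))| ≤ 2 * δ - C₁ * δ ^ 3
    have : C₁ * δ ^ 3 ≤ δ :=
      calc C₁ * δ ^ 3 = (C₁ * δ ^ 2) * δ := by ring
        _ ≤ 1 * δ := mul_le_mul_of_nonneg_right hC₁δ hδ.le
        _ = δ := one_mul δ
    linarith
  mean := hmean
  key := hkey
  drv_at k _ ω := rfl
  drv_osc k _ ω s h₁ h₂ := by
    have h := (sampledData_step (drv := drv) (τ := τ) hδ.le k ω).2.2.1 s h₁ h₂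
    show |drv ω s - drv ω (capStop (drv ω) δ (min k (τ ω)))| ≤ 2 * δ
    linarith [abs_nonneg (drv ω s - drv ω (capStop (drv ω) δ (min k (τ ω))))]

/-- **The lower bound fails only after truncation**: the event
`{∃ k < N, (ΔΔ_k)² + Δt_k < δ²}` charged by the engine (`exists_delta_forall_coupling_lt`) is
contained in `{τ < N}` — for untruncated sampling it is empty ([LSW04] §3.3: "By the definition of
the `t_{m_n}`, we have `Y_{n+1} - Y_n + t_{m_{n+1}} - t_{m_n} ≥ δ²`"; proof of Thm. 4.4 for the
truncated case). [cite: LawlerSchrammWerner2004, Theorem 3.7] -/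
theorem sampledData_lowerFailSet_subset (hδ : 0 ≤ δ) (N : ℕ) :
    {ω | ∃ k < N, ((sampledData P H drv τ δ κ C₁ C₂).dval (k + 1) ω -
        (sampledData P H drv τ δ κ C₁ C₂).dval k ω) ^ 2 +
      (((sampledData P H drv τ δ κ C₁ C₂).tcap (k + 1) ω : ℝ) -
        (sampledData P H drv τ δ κ C₁ C₂).tcap k ω) < (sampledData P H drv τ δ κ C₁ C₂).δ ^ 2} ⊆
    {ω | τ ω < N} := by
  rintro ω ⟨k, hk, hlt⟩
  simp only [sampledData_dval, sampledData_tcap] at hlt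
  change _ < δ ^ 2 at hlt
  rcases (sampledData_step (drv := drv) (τ := τ) hδ k ω).2.2.2 with h | h
  · -- frozen at `k`: `τ ω ≤ k < N`
    have : τ ω ≤ k := by
      by_contra hc
      push Not at hc
      rw [min_eq_left hc, min_eq_left hc.le] at h
      omega
    exact lt_of_le_of_lt this hk
  · exact absurd hlt (not_lt.2 h)

end Sampled

end Literature.Probability.RandomPlanarGeometry.SkorokhodEmbedding

end
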